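import Summits.QuantumAdvantage.QuantumAdvantage.Theorems.LinnikCubicClassGroupsDegreeOnePrimesEscapeRayClassShortIntervalDegOne
import Literature.NumberTheory.QuadraticFields.RingClassPrimeForms
import Literature.NumberTheory.NumberFields.RingClassFieldGaloisDegree
import Literature.NumberTheory.QuadraticFields.ClassNumberConductorFormula
import Literature.NumberTheory.QuadraticFields.ClassNumberLeAbs
import HarnessLib

/-!
# Primes represented by a positive definite binary quadratic form: the least such prime is `≤ |D|^L`,
# every form represents a prime in every short interval `(x, x + x^{1−δ}]`, `x ≥ |D|^L`, and infinitely many primes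
# (Fogels, Weiss 1983, Thorner–Zaman 2017 Thm. 1.2; Dirichlet 1840 / Weber 1882 / Cox Thm. 9.12) — unconditionally

Topic `Summits/QuantumAdvantage/QuantumAdvantage/Theorems`, cell B2b-1 (linnik-cubic), PART A (gen 39); helper toward the
crux `DegreeOnePrimesEscape` (stmt-QuantumAdvantage-11543) of route `LinnikCubicClassGroups`.  HONEST FRAMING: the value of
this file is a THEOREM (kernel-checked, GRH-free, Siegel-free: a CERTIFICATION, with a non-explicit exponent `L`, of results
in print) — NOT summit progress (the route still rests on the hypothesis-type target `PureCubicClassNumberHard`).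

Let `Q(x, y) = ax² + bxy + cy²` be a PRIMITIVE POSITIVE DEFINITE binary quadratic form of discriminant `D = b² − 4ac < 0`
(the tree's `Quadratic.BinQF`, `IsPosPrim D Q`).  Write `D = f² d_K` with `K = ℚ(√D)` imaginary quadratic and `f ≥ 1`
(`exists_quadraticField_of_neg`).  The classes of such forms are the ring class group `I_K(f)/P_{K,ℤ}(f)`
(`RingClassForms`: `q ↦ [𝔄_q]`), the datum `𝔭 ↦ [𝔭] ∈ I_K(f)/P_{K,ℤ}(f)` kills the ray `mod f𝓞_K` and its non-trivial
characters are non-principal off `f` (`artinKillsRay_primeClass`, `exists_charFun_primeClass_ne_one`), its size is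
`h(D) ≤ |D| ≤ Q_𝔪`, `Q_𝔪 = 4|d_K| N(f𝓞_K) = 4|D|` — so the cell's UNCONDITIONAL Linnik theorem for degree-one primes in
the cosets of a congruence class group (`exists_degOnePrime_fiber_absNorm_le`, `…_mem_Ioc`, Weiss 1983 Thm. 6.4 shape)
applies; and a degree-one prime `𝔭 ∤ f` of norm `p` in the class `[𝔄_Q]` makes `Q` represent `p`
(`RingClass.exists_eval_eq_absNorm_of_mk_eq_primeClass`, Cox Thm. 7.7 / 9.12).  Results:

* `exists_prime_eval_eq_le_rayCondQ` — field-level form: `∃ L > 0`, for every imaginary quadratic `K`, `f ≥ 1` and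
  primitive positive definite `Q` of discriminant `f² d_K`, some prime `p ≤ (4 f² |d_K|)^L` is represented by `Q`;
* **`exists_prime_represented_le_rpow`** — **THE LEAST PRIME REPRESENTED BY A POSITIVE DEFINITE BINARY QUADRATIC FORM is
  `≤ |D|^L`**: there is an absolute `L > 0` such that every primitive positive definite form of discriminant `D < 0`
  represents a prime `p ≤ |D|^L` ([ThornerZaman2017, Thm. 1.2] with `694` in place of `L`; Fogels 1962, Weiss 1983);
* **`exists_prime_represented_mem_Ioc`** — **primes represented by `Q` in all short intervals of the Linnik range**:
  there are absolute `δ, L > 0` such that for `x ≥ |D|^L` and `x^{1−δ} ≤ h ≤ x` every such form represents a prime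
  `p ∈ (x, x + h]`;
* **`infinite_setOf_prime_represented`** — **every primitive positive definite form represents infinitely many primes**
  (Dirichlet 1840 for the principal genus, Weber 1882; [Cox2013, Thm. 9.12]);
* `exists_prime_eq_sq_add_mul_sq_le`, `infinite_setOf_prime_eq_sq_add_mul_sq` — the case `x² + ny²`: **the least prime of
  the form `x² + ny²` is `≤ (4n)^L`**, and there are infinitely many such primes.

## References
* J. Thorner, A. Zaman, Algebra Number Theory 11 (2017) 1135–1197, Thm. 1.2 and §12. [ThornerZaman2017]
* A. Weiss, *The least prime ideal*, J. reine angew. Math. 338 (1983) 56–94, Thm. 6.4. [Weiss1983]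
* D. A. Cox, *Primes of the form x² + ny²*, 2nd ed., Wiley (2013), §7.B–C, §9.B Thm. 9.12. [Cox2013]
-/

noncomputable section

open Complex Real Set Filter Topology NumberField IsDedekindDomain Module
open scoped NumberField nonZeroDivisors QuadraticAlgebra

namespace Summit.QuantumAdvantage.QuantumAdvantage.Theorems.DegreeOnePrimesEscape

open Literature.NumberTheory.LFunctions Literature.NumberTheory.LFunctions.NumberField
  Literature.NumberTheory.LFunctions.AbelianDensity Literature.NumberTheory.GaloisRepresentations
open Literature.NumberTheory.NumberFields Literature.NumberTheory.NumberFields.RingClassField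
open Literature.NumberTheory.QuadraticFields Literature.NumberTheory.QuadraticFields.RingClass
open Literature.NumberTheory.QuadraticFields.Quadratic Literature.NumberTheory.QuadraticFields.Quadratic.BinQF
open Literature.NumberTheory.EllipticCurves
open Literature.Computability.Cryptography.Hallgren2005.OrderCl
open scoped Classical

/-! ### Bookkeeping: `Q_{f𝓞_K} = 4 f² |d_K| = 4|D|` and `h(D) ≤ Q_{f𝓞_K}⁴` -/

/-- `Q_𝔪 = |d_K| · 2² · N(f𝓞_K) = 4 f² |d_K|` for a quadratic field. -/
theorem rayCondQ_span_eq_of_quadratic {K : Type} [Field K] [NumberField K] (h2 : finrank ℚ K = 2) (f : ℕ) :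
    rayCondQ K (Ideal.span {(f : 𝓞 K)}) = 4 * (f : ℝ) ^ 2 * |(NumberField.discr K : ℝ)| := by
  rw [rayCondQ, ThornerZaman.condQn, Ideal.absNorm_span_natCast, RingOfIntegers.rank, h2]
  push_cast
  ring

/-- `(f) ≠ 0` for `f ≠ 0`. -/
theorem span_natCast_ne_bot' {K : Type} [Field K] [NumberField K] {f : ℕ} (hf : f ≠ 0) :
    (Ideal.span {(f : 𝓞 K)} : Ideal (𝓞 K)) ≠ ⊥ := by
  rw [Ne, Ideal.span_singleton_eq_bot]
  exact_mod_cast hf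

/-- **Size of the ring class group against the conductor parameter**: `#(I_K(f)/P_{K,ℤ}(f)) = h(f² d_K) ≤ f²|d_K| ≤ Q_𝔪⁴`. -/
theorem natCard_ringClassGroup_le_rayCondQ_pow {K : Type} [Field K] [NumberField K] (hK : IsImaginaryQuadratic K)
    {f : ℕ} (hf : f ≠ 0) :
    (Nat.card (RingClassGroup K f) : ℝ) ≤ rayCondQ K (Ideal.span {(f : 𝓞 K)}) ^ (4 : ℕ) := by
  have h2 : finrank ℚ K = 2 := hK.1
  have hDneg : (f : ℤ) ^ 2 * NumberField.discr K < 0 :=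
    mul_neg_of_pos_of_neg (pow_pos (by exact_mod_cast Nat.pos_of_ne_zero hf) 2) hK.discr_neg
  have hcard := card_ringClassGroup_eq_classNumber hK hf
  have hle := BinaryQuadraticForm.classNumber_le_natAbs hDneg
  have hR : rayCondQ K (Ideal.span {(f : 𝓞 K)}) = 4 * (f : ℝ) ^ 2 * |(NumberField.discr K : ℝ)| :=
    rayCondQ_span_eq_of_quadratic h2 f
  have hR12 : (12 : ℝ) ≤ rayCondQ K (Ideal.span {(f : 𝓞 K)}) :=
    twelve_le_rayCondQ (by rw [h2]; norm_num) (span_natCast_ne_bot' hf)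
  have habs : (((f : ℤ) ^ 2 * NumberField.discr K).natAbs : ℝ) = (f : ℝ) ^ 2 * |(NumberField.discr K : ℝ)| := by
    rw [Nat.cast_natAbs, Int.cast_abs]; push_cast
    rw [abs_mul, abs_pow, abs_of_nonneg (Nat.cast_nonneg _)]
  calc (Nat.card (RingClassGroup K f) : ℝ) = (BinaryQuadraticForm.classNumber ((f : ℤ) ^ 2 * NumberField.discr K) : ℝ) := by
        rw [hcard]
    _ ≤ (((f : ℤ) ^ 2 * NumberField.discr K).natAbs : ℝ) := by exact_mod_cast hle
    _ = (f : ℝ) ^ 2 * |(NumberField.discr K : ℝ)| := habs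
    _ ≤ rayCondQ K (Ideal.span {(f : 𝓞 K)}) := by rw [hR]; nlinarith [abs_nonneg (NumberField.discr K : ℝ), sq_nonneg (f : ℝ)]
    _ = rayCondQ K (Ideal.span {(f : 𝓞 K)}) ^ (1 : ℕ) := (pow_one _).symm
    _ ≤ rayCondQ K (Ideal.span {(f : 𝓞 K)}) ^ (4 : ℕ) := pow_le_pow_right₀ (by linarith) (by norm_num)

/-- `Q_{f𝓞_K} = 4|D|` when `D = f² d_K`. -/
theorem rayCondQ_span_eq_four_mul_abs {K : Type} [Field K] [NumberField K] (h2 : finrank ℚ K = 2) {f : ℕ} {D : ℤ}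
    (hDf : D = (f : ℤ) ^ 2 * NumberField.discr K) :
    rayCondQ K (Ideal.span {(f : 𝓞 K)}) = 4 * |(D : ℝ)| := by
  rw [rayCondQ_span_eq_of_quadratic h2 f, hDf]
  push_cast
  rw [abs_mul, abs_of_nonneg (sq_nonneg (f : ℝ))]
  ring

/-- `(4|D|)^L ≤ |D|^{3L}` for a negative discriminant (`D ≤ −3`). -/
theorem four_mul_abs_rpow_le {D : ℤ} (hD : D ≤ -3) {L : ℝ} (hL : 0 ≤ L) :
    (4 * |(D : ℝ)|) ^ L ≤ |(D : ℝ)| ^ (3 * L) := by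
  have hD3 : (3 : ℝ) ≤ |(D : ℝ)| := by
    rw [abs_of_neg (by exact_mod_cast (show D < 0 by omega))]
    have : ((D : ℝ)) ≤ -3 := by exact_mod_cast hD
    linarith
  have hD0 : (0 : ℝ) ≤ |(D : ℝ)| := abs_nonneg _
  have hsq : (9 : ℝ) ≤ |(D : ℝ)| ^ 2 := by nlinarith
  have h43 : 4 * |(D : ℝ)| ≤ |(D : ℝ)| ^ (3 : ℝ) := by
    rw [show (3 : ℝ) = ((3 : ℕ) : ℝ) by norm_num, Real.rpow_natCast]
    calc 4 * |(D : ℝ)| ≤ 9 * |(D : ℝ)| := by linarith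
      _ ≤ |(D : ℝ)| ^ 2 * |(D : ℝ)| := mul_le_mul_of_nonneg_right hsq hD0
      _ = |(D : ℝ)| ^ (3 : ℕ) := by ring
  calc (4 * |(D : ℝ)|) ^ L ≤ (|(D : ℝ)| ^ (3 : ℝ)) ^ L := Real.rpow_le_rpow (by positivity) h43 hL
    _ = |(D : ℝ)| ^ (3 * L) := by rw [← Real.rpow_mul hD0]

/-! ### The least prime represented by a form of discriminant `f² d_K` -/

/-- **Field-level form**: there is an absolute `L > 0` such that for every imaginary quadratic field `K`, every `f ≥ 1`
and every primitive positive definite form `Q` of discriminant `f² d_K`, some prime `p ≤ Q_{f𝓞_K}^L = (4f²|d_K|)^L` is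
represented by `Q` — the cell's `exists_degOnePrime_fiber_absNorm_le` for the ring-class datum, then Cox Thm. 7.7.
[cite: ThornerZaman2017, Theorem 1.2] [cite: Weiss1983, Theorem 6.4] -/
theorem exists_prime_eval_eq_le_rayCondQ :
    ∃ L : ℝ, 0 < L ∧ ∀ (K : Type) [Field K] [NumberField K], IsImaginaryQuadratic K →
      ∀ (f : ℕ), f ≠ 0 → ∀ Q : BinQF, Q.IsPosPrim ((f : ℤ) ^ 2 * NumberField.discr K) →
        ∃ p : ℕ, p.Prime ∧ (p : ℝ) ≤ rayCondQ K (Ideal.span {(f : 𝓞 K)}) ^ L ∧ ∃ x y : ℤ, Q.eval x y = p := by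
  obtain ⟨L, hL, hmain⟩ := exists_degOnePrime_fiber_absNorm_le 2 one_lt_two
  refine ⟨L, hL, fun K _ _ hK f hf Q hQ ↦ ?_⟩
  have h2 : finrank ℚ K = 2 := hK.1
  -- the order data `O_D ↪ 𝓞 K`, `D = f² d_K`
  obtain ⟨b, hb⟩ := exists_basis_zero_eq_one h2
  set m : ℤ := b.repr (b 1 * b 1) 0 with hm
  set t : ℤ := b.repr (b 1 * b 1) 1 with ht
  have hω : b 1 * b 1 = (m : 𝓞 K) + (t : 𝓞 K) * b 1 := basis_one_mul_self_eq b hb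
  have hdK : NumberField.discr K = t ^ 2 + 4 * m := discr_eq_sq_add_four_mul b hb
  have hDneg : (f : ℤ) ^ 2 * NumberField.discr K < 0 :=
    mul_neg_of_pos_of_neg (pow_pos (by exact_mod_cast Nat.pos_of_ne_zero hf) 2) hK.discr_neg
  set Δ : NegDiscr := ⟨(f : ℤ) ^ 2 * NumberField.discr K, hDneg⟩ with hΔ
  have hD : Δ.D = (f : ℤ) ^ 2 * (t ^ 2 + 4 * m) := by simp only [hΔ]; rw [hdK]
  obtain ⟨s, hs'⟩ := two_dvd_sub hD
  have hs : 2 * s = Δ.D - f * t := hs'.symm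
  obtain ⟨ι, hι⟩ := exists_ringHom b hω hD hs
  haveI : Finite (RingClassGroup K f) := finite_ringClassGroup h2 hf
  -- a representative `Q'` of the class of `Q` with `gcd(a, f) = 1`, and its ring class `τ`
  have hfZ : (f : ℤ) ≠ 0 := by exact_mod_cast hf
  have hQΔ : Q.IsPosPrim Δ.D := hQ
  obtain ⟨Q', hQQ', hQ', hQ'a⟩ := exists_properEquiv_isPosPrim_isCoprime_a Δ.neg hQΔ hfZ
  set τ : RingClassGroup K f := QuotientGroup.mk ⟨_, mk0_map_fIdeal_mem ι hQ' hQ'a⟩ with hτ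
  -- the analytic input
  have h𝔪 := span_natCast_ne_bot' (K := K) hf
  obtain ⟨v, hv, hfv, hprime, hle⟩ := hmain K h2 (RingClassGroup K f) (Ideal.span {(f : 𝓞 K)}) (primeClass f) h𝔪
    (artinKillsRay_primeClass f) (fun χ hχ ↦ exists_charFun_primeClass_ne_one f χ hχ)
    (natCard_ringClassGroup_le_rayCondQ_pow hK hf) τ
  -- `Q'`, hence `Q`, represents `p = N v`
  have hrep : ∃ x y : ℤ, Q'.eval x y = Ideal.absNorm v.asIdeal :=
    exists_eval_eq_absNorm_of_mk_eq_primeClass b hb hω hD hs ι hι hf hQ' hQ'a v hv hprime hfv.symm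
  exact ⟨Ideal.absNorm v.asIdeal, hprime, hle, hQQ'.symm.exists_eval_eq hrep⟩

/-- **THE LEAST PRIME REPRESENTED BY A POSITIVE DEFINITE BINARY QUADRATIC FORM** (Thorner–Zaman 2017, Thm. 1.2, with a
non-explicit absolute exponent; Fogels 1962, Weiss 1983): there is an absolute constant `L > 0` such that every primitive
positive definite binary quadratic form `Q(x, y) = ax² + bxy + cy² ∈ ℤ[x, y]` of discriminant `D = b² − 4ac < 0` represents
a prime `p ≤ |D|^L`.  Unconditional (no GRH, no Siegel hypothesis): `D = f² d_K`, `Q_{f𝓞_K} = 4|D| ≤ |D|³`.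
[cite: ThornerZaman2017, Theorem 1.2] -/
theorem exists_prime_represented_le_rpow :
    ∃ L : ℝ, 0 < L ∧ ∀ (D : ℤ), D < 0 → ∀ Q : BinQF, Q.IsPosPrim D →
      ∃ p : ℕ, p.Prime ∧ (p : ℝ) ≤ |(D : ℝ)| ^ L ∧ ∃ x y : ℤ, Q.eval x y = p := by
  obtain ⟨L, hL, hmain⟩ := exists_prime_eval_eq_le_rayCondQ
  refine ⟨3 * L, by positivity, fun D hD Q hQ ↦ ?_⟩
  obtain ⟨K, _, _, h2, hneg, f, hf, hDf⟩ := BinaryQuadraticForm.exists_quadraticField_of_neg hD hQ.emod_four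
  have hK : IsImaginaryQuadratic K := isImaginaryQuadratic_iff_discr_neg.mpr ⟨h2, hneg⟩
  have hQ' : Q.IsPosPrim ((f : ℤ) ^ 2 * NumberField.discr K) := hDf ▸ hQ
  obtain ⟨p, hp, hle, hrep⟩ := hmain K hK f hf Q hQ'
  refine ⟨p, hp, le_trans hle ?_, hrep⟩
  -- `Q_𝔪 = 4|D| ≤ |D|³` since `|D| ≥ 3`
  have h4 := hQ.emod_four
  rw [rayCondQ_span_eq_four_mul_abs h2 hDf]
  exact four_mul_abs_rpow_le (by omega) hL.le

/-! ### Primes represented by a form in every short interval of the Linnik range -/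

/-- **Field-level short-interval form**: absolute `δ, L > 0` such that for every imaginary quadratic `K`, `f ≥ 1`, every
primitive positive definite `Q` of discriminant `f² d_K`, every `x ≥ Q_{f𝓞_K}^L` and `x^{1−δ} ≤ h ≤ x`, some prime
`p ∈ (x, x + h]` is represented by `Q` (the cell's `exists_degOnePrime_fiber_absNorm_mem_Ioc` for the ring-class datum).
[cite: Weiss1983, Theorem 6.4] [cite: ThornerZaman2017, Theorem 1.2] -/
theorem exists_prime_eval_eq_mem_Ioc_rayCondQ :
    ∃ δ L : ℝ, 0 < δ ∧ 0 < L ∧ ∀ (K : Type) [Field K] [NumberField K], IsImaginaryQuadratic K →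
      ∀ (f : ℕ), f ≠ 0 → ∀ Q : BinQF, Q.IsPosPrim ((f : ℤ) ^ 2 * NumberField.discr K) →
        ∀ x h : ℝ, rayCondQ K (Ideal.span {(f : 𝓞 K)}) ^ L ≤ x → x ^ (1 - δ) ≤ h → h ≤ x →
          ∃ p : ℕ, p.Prime ∧ x < (p : ℝ) ∧ (p : ℝ) ≤ x + h ∧ ∃ a c : ℤ, Q.eval a c = p := by
  obtain ⟨δ, L, hδ, hL, hmain⟩ := exists_degOnePrime_fiber_absNorm_mem_Ioc 2 one_lt_two
  refine ⟨δ, L, hδ, hL, fun K _ _ hK f hf Q hQ x h hx hhx hhx' ↦ ?_⟩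
  have h2 : finrank ℚ K = 2 := hK.1
  obtain ⟨b, hb⟩ := exists_basis_zero_eq_one h2
  set m : ℤ := b.repr (b 1 * b 1) 0 with hm
  set t : ℤ := b.repr (b 1 * b 1) 1 with ht
  have hω : b 1 * b 1 = (m : 𝓞 K) + (t : 𝓞 K) * b 1 := basis_one_mul_self_eq b hb
  have hdK : NumberField.discr K = t ^ 2 + 4 * m := discr_eq_sq_add_four_mul b hb
  have hDneg : (f : ℤ) ^ 2 * NumberField.discr K < 0 :=
    mul_neg_of_pos_of_neg (pow_pos (by exact_mod_cast Nat.pos_of_ne_zero hf) 2) hK.discr_neg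
  set Δ : NegDiscr := ⟨(f : ℤ) ^ 2 * NumberField.discr K, hDneg⟩ with hΔ
  have hD : Δ.D = (f : ℤ) ^ 2 * (t ^ 2 + 4 * m) := by simp only [hΔ]; rw [hdK]
  obtain ⟨s, hs'⟩ := two_dvd_sub hD
  have hs : 2 * s = Δ.D - f * t := hs'.symm
  obtain ⟨ι, hι⟩ := exists_ringHom b hω hD hs
  haveI : Finite (RingClassGroup K f) := finite_ringClassGroup h2 hf
  have hfZ : (f : ℤ) ≠ 0 := by exact_mod_cast hf
  have hQΔ : Q.IsPosPrim Δ.D := hQ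
  obtain ⟨Q', hQQ', hQ', hQ'a⟩ := exists_properEquiv_isPosPrim_isCoprime_a Δ.neg hQΔ hfZ
  set τ : RingClassGroup K f := QuotientGroup.mk ⟨_, mk0_map_fIdeal_mem ι hQ' hQ'a⟩ with hτ
  have h𝔪 := span_natCast_ne_bot' (K := K) hf
  obtain ⟨v, hv, hfv, hprime, hxv, hvx⟩ := hmain K h2 (RingClassGroup K f) (Ideal.span {(f : 𝓞 K)}) (primeClass f)
    h𝔪 (artinKillsRay_primeClass f) (fun χ hχ ↦ exists_charFun_primeClass_ne_one f χ hχ)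
    (natCard_ringClassGroup_le_rayCondQ_pow hK hf) x h hx hhx hhx' τ
  have hrep : ∃ x y : ℤ, Q'.eval x y = Ideal.absNorm v.asIdeal :=
    exists_eval_eq_absNorm_of_mk_eq_primeClass b hb hω hD hs ι hι hf hQ' hQ'a v hv hprime hfv.symm
  exact ⟨Ideal.absNorm v.asIdeal, hprime, hxv, hvx, hQQ'.symm.exists_eval_eq hrep⟩

/-- **PRIMES REPRESENTED BY A POSITIVE DEFINITE FORM IN EVERY SHORT INTERVAL OF THE LINNIK RANGE**: there are absolute
`δ, L > 0` such that for every primitive positive definite binary quadratic form `Q` of discriminant `D < 0`, every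
`x ≥ |D|^L` and every `h` with `x^{1−δ} ≤ h ≤ x`, some prime `p ∈ (x, x + h]` is represented by `Q`.  Unconditional.
[cite: ThornerZaman2017, Theorem 1.2] [cite: Weiss1983, Theorem 6.4] -/
theorem exists_prime_represented_mem_Ioc :
    ∃ δ L : ℝ, 0 < δ ∧ 0 < L ∧ ∀ (D : ℤ), D < 0 → ∀ Q : BinQF, Q.IsPosPrim D →
      ∀ x h : ℝ, |(D : ℝ)| ^ L ≤ x → x ^ (1 - δ) ≤ h → h ≤ x →
        ∃ p : ℕ, p.Prime ∧ x < (p : ℝ) ∧ (p : ℝ) ≤ x + h ∧ ∃ a c : ℤ, Q.eval a c = p := by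
  obtain ⟨δ, L, hδ, hL, hmain⟩ := exists_prime_eval_eq_mem_Ioc_rayCondQ
  refine ⟨δ, 3 * L, hδ, by positivity, fun D hD Q hQ x h hx hhx hhx' ↦ ?_⟩
  obtain ⟨K, _, _, h2, hneg, f, hf, hDf⟩ := BinaryQuadraticForm.exists_quadraticField_of_neg hD hQ.emod_four
  have hK : IsImaginaryQuadratic K := isImaginaryQuadratic_iff_discr_neg.mpr ⟨h2, hneg⟩
  have hQ' : Q.IsPosPrim ((f : ℤ) ^ 2 * NumberField.discr K) := hDf ▸ hQ
  refine hmain K hK f hf Q hQ' x h (le_trans ?_ hx) hhx hhx'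
  have h4 := hQ.emod_four
  rw [rayCondQ_span_eq_four_mul_abs h2 hDf]
  exact four_mul_abs_rpow_le (by omega) hL.le

/-! ### Dirichlet–Weber: a primitive positive definite form represents infinitely many primes -/

/-- **Every primitive positive definite binary quadratic form represents infinitely many primes** (Dirichlet 1840,
Weber 1882; Cox, Thm. 9.12): from the short-interval theorem, for every `N` there is a represented prime `> N`.
[cite: Cox2013, §9.B Theorem 9.12] -/
theorem infinite_setOf_prime_represented {D : ℤ} (hD : D < 0) {Q : BinQF} (hQ : Q.IsPosPrim D) :
    {p : ℕ | p.Prime ∧ ∃ x y : ℤ, Q.eval x y = p}.Infinite := by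
  obtain ⟨δ, L, hδ, hL, hmain⟩ := exists_prime_represented_mem_Ioc
  refine Set.infinite_of_forall_exists_gt fun N ↦ ?_
  -- take `x = max (|D|^L) N`, `h = x`
  set x : ℝ := max (|(D : ℝ)| ^ L) ((N : ℝ) + 1) with hxdef
  have hD3 : (1 : ℝ) ≤ |(D : ℝ)| := by
    rw [abs_of_neg (by exact_mod_cast hD)]
    have : ((D : ℝ)) ≤ -1 := by exact_mod_cast (show D ≤ -1 by omega)
    linarith
  have hx1 : (1 : ℝ) ≤ x := le_trans (by have := Nat.cast_nonneg (α := ℝ) N; linarith) (le_max_right _ _)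
  have hx0 : 0 ≤ x := by linarith
  have hxδ : x ^ (1 - δ) ≤ x := by
    calc x ^ (1 - δ) ≤ x ^ (1 : ℝ) := Real.rpow_le_rpow_of_exponent_le hx1 (by linarith)
      _ = x := Real.rpow_one x
  obtain ⟨p, hp, hxp, -, hrep⟩ := hmain D hD Q hQ x x (le_max_left _ _) hxδ le_rfl
  refine ⟨p, ⟨hp, hrep⟩, ?_⟩
  have : (N : ℝ) < p := lt_of_lt_of_le (by linarith [le_max_right (|(D : ℝ)| ^ L) ((N : ℝ) + 1)]) hxp.le
  exact_mod_cast this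

/-! ### Primes of the form `x² + ny²` -/

/-- The principal form `x² + ny²` is primitive with leading coefficient `1` and discriminant `−4n`. -/
theorem isPosPrim_sq_add_mul_sq (n : ℕ) : (⟨1, 0, n⟩ : BinQF).IsPosPrim (-4 * (n : ℤ)) :=
  ⟨by simp [BinQF.disc], one_pos, by simp [BinQF.IsPrimitive]⟩

/-- **THE LEAST PRIME OF THE FORM `x² + ny²` IS `≤ (4n)^L`**: there is an absolute `L > 0` such that for every `n ≥ 1`
some prime `p ≤ (4n)^L` is of the form `x² + ny²` (the case `Q = x² + ny²`, `D = −4n`, of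
`exists_prime_represented_le_rpow`).  Unconditional. [cite: ThornerZaman2017, Theorem 1.2] -/
theorem exists_prime_eq_sq_add_mul_sq_le :
    ∃ L : ℝ, 0 < L ∧ ∀ n : ℕ, 0 < n →
      ∃ p : ℕ, p.Prime ∧ (p : ℝ) ≤ (4 * (n : ℝ)) ^ L ∧ ∃ x y : ℤ, x ^ 2 + n * y ^ 2 = p := by
  obtain ⟨L, hL, hmain⟩ := exists_prime_represented_le_rpow
  refine ⟨L, hL, fun n hn ↦ ?_⟩
  obtain ⟨p, hp, hle, x, y, hxy⟩ := hmain (-4 * (n : ℤ)) (by omega) ⟨1, 0, n⟩ (isPosPrim_sq_add_mul_sq n)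
  refine ⟨p, hp, ?_, x, y, ?_⟩
  · have habs : |((-4 * (n : ℤ) : ℤ) : ℝ)| = 4 * (n : ℝ) := by
      push_cast
      rw [abs_of_nonpos (by have := Nat.cast_nonneg (α := ℝ) n; linarith)]
      ring
    rwa [habs] at hle
  · rw [← hxy]
    simp [BinQF.eval]

/-- **There are infinitely many primes of the form `x² + ny²`** for every `n ≥ 1` (Dirichlet; Cox, Thm. 9.12 for the
principal form). [cite: Cox2013, §9.B Theorem 9.12] -/
theorem infinite_setOf_prime_eq_sq_add_mul_sq {n : ℕ} (hn : 0 < n) :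
    {p : ℕ | p.Prime ∧ ∃ x y : ℤ, x ^ 2 + n * y ^ 2 = p}.Infinite := by
  have h := infinite_setOf_prime_represented (by omega : -4 * (n : ℤ) < 0) (isPosPrim_sq_add_mul_sq n)
  refine h.mono fun p hp ↦ ⟨hp.1, ?_⟩
  obtain ⟨x, y, hxy⟩ := hp.2
  refine ⟨x, y, ?_⟩
  rw [← hxy]
  simp [BinQF.eval]

end Summit.QuantumAdvantage.QuantumAdvantage.Theorems.DegreeOnePrimesEscape

end
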